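import Summits.BirchSwinnertonDyer.BirchSwinnertonDyer.Theorems.ErratumRoadFiveShimuraKolyvaginOrderBoundInertMachineEntry
import Summits.BirchSwinnertonDyer.BirchSwinnertonDyer.Theorems.ClassRecordThreeShimuraKolyvaginOrderBoundAtThreeSurjDeepLevel
import Summits.BirchSwinnertonDyer.Rank1Residual.X11b.KolyvaginHloc
import HarnessLib

/-!
# Kolyvagin's ORDER bound, conductor-keyed, run at DEPTH `2M₀ + k` — part 6′: McCallum's Lemma 5.3 for the
# Cassels–Tate local term at a Kolyvagin prime of depth `p^{2M₀+k}` (`hloc`), from local duality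

Cell `bsd-stepL` (run/shared/lean/pub/bsd-stepL/), seat `bsd-stepL-shim3a` (prover g2), HELPER for the crux
`Summit.BirchSwinnertonDyer.BirchSwinnertonDyer.Theses.ClassRecordThree.ShimuraKolyvaginOrderBoundAtThreeSurj`
(item stmt-BirchSwinnertonDyer-19899; `--supports … --as helper`); serves S2 of item 19718 and item 19627 too.
Road memo HOME/shim/SHIM3A-G2-ROAD-19899.md §2 (ε₃). Companion of `…SurjOrderCTValue` ∕ `…OrderReciprocity` ∕
`…OrderLeaves` ∕ `…OrderBound`.

## What

`hloc_of_localDuality_shift` — the conductor-keyed twin `hloc_of_localDuality_of_conductorNorm` (p479222) of x11b3's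
`KolyvaginCT.hloc_of_localDuality` with the Kolyvagin-prime predicate ONE LEVEL DEEPER
(`… ∧ FrobEqFrobInfty W K (p ^ (2 * M₀ + k)) ·`; the classes' level Frobenius fed through `frobEqFrobInfty_of_dvd`)
(`X11b/KolyvaginHloc.lean`: the hypothesis `hloc` of `KolyvaginDescent.card_quotient_selmer_le_of_localTerm` —
McCallum's Lemma 5.3 for the Cassels–Tate local term at a Kolyvagin prime `λ`: `inv_λ((loc_λ D.b₁ - β_λ) ∪ β'_λ) ≠ 0`
for the first-case data of a Kolyvagin pair — DISCHARGED from the Weil pairing being alternating and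
non-degenerate, injective local invariants at the finite places, leaf (A) `hcl`, `K` imaginary quadratic with
conjugation `c`, and good reduction at the Kolyvagin primes). Statement = the tree's with
`(hP : IsHeegnerPoint N₀ W K Pt)` replaced by `(hN : W.conductorNorm ℤ = N₀)` (its only use: `hgood`); proof =
the tree's token for token with shim-p1's `hasGoodReductionAt_place_of_isKolyvaginPrime_of_conductorNorm`.

## Honest framing

THEOREMS ONLY (no `def`, no named fact, no `sorry`; axioms standard). Nothing here constructs an Euler system
or discharges a Cassels–Tate input; item 19899 stays OPEN. BSD is not proved by any of this.

## References

[cite: McCallumLMS1991, §1 Theorem, §5 Lemma 5.3, Thm. 5.4, Cor. 5.6] [cite: GrossLMS1991, §7 (7.6), Prop. 8.2, §9]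
[cite: MilneADT2006, Ch. I §6, Prop. 6.9, Thm. 6.13(a)]
presearch: not applicable (re-keying of tree theorems). Tree: `lean search 'hloc_of_localDuality_shift'` → none.
-/

noncomputable section

open scoped Classical Pointwise
set_option linter.dupNamespace false
namespace Summit.BirchSwinnertonDyer.BirchSwinnertonDyer.Theorems.ShimuraKolyvaginOrder

open WeierstrassCurve NumberField IsDedekindDomain Field Function
open Literature.NumberTheory.EllipticCurves Literature.NumberTheory.EllipticCurves.KolyvaginDescent
open Literature.NumberTheory.GaloisRepresentations
open Literature.NumberTheory.GaloisCohomology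
open Literature.NumberTheory.GaloisRepresentations.DiscreteGaloisModule (mu MuCarrier)
open Summit.BirchSwinnertonDyer.Rank1Residual.X11b Summit.BirchSwinnertonDyer.Rank1Residual.X11b.KolyvaginCT
open Summit.BirchSwinnertonDyer.BirchSwinnertonDyer.Theorems
open Summit.BirchSwinnertonDyer.BirchSwinnertonDyer.Theorems.ShimuraKolyvaginLocalShift (frobEqFrobInfty_of_dvd)

-- Cup products need `LocallyCompactSpace Γ_K`; as in the tree's Cassels–Tate files.
attribute [local instance] absoluteGaloisGroup_compactSpace

-- `CharZero` of the completions (the Cassels–Tate local terms), as in the tree's files.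
attribute [local instance] charZero_placeCompletion

variable (W : WeierstrassCurve ℚ) {K : Type} [Field K] [NumberField K]

/-- **`hloc` from local duality, conductor-keyed, depth `2M₀ + k`** — twin of x11b3's `KolyvaginCT.hloc_of_localDuality`
(McCallum's Lemma 5.3 for the Cassels–Tate local term at a Kolyvagin prime; module docstring), for `e`
alternating and non-degenerate and `inv_v` injective at the finite places, with the Heegner-point binder of the
tree replaced by `hN : W.conductorNorm ℤ = N₀`. [cite: McCallumLMS1991, §5 Lemma 5.3, Thm. 5.4]
[cite: GrossLMS1991, §7 (7.6), Prop. 8.2] [cite: MilneADT2006, Ch. I §6, proof of Prop. 6.9] -/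
theorem hloc_of_localDuality_shift [W.IsElliptic] (hK : IsImaginaryQuadratic K)
    {N₀ : ℕ} [NeZero N₀] (hN : W.conductorNorm ℤ = N₀) (k : ℕ)
    {p : ℕ} (hp : p.Prime) (hp2 : p ≠ 2) {M₀ : ℕ} (hM₀ : 1 ≤ M₀) [NeZero (p ^ M₀)]
    {c : K ≃ₐ[ℚ] K} (hc : c ≠ 1) (ε : ℤ) (hε : ε = 1 ∨ ε = -1)
    (cl : ℕ → galH1Torsion (W.baseChange K) ((p ^ M₀ * p ^ M₀ : ℕ) : ℤ))
    (hcl : ∀ m : ℕ, Squarefree m →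
      (∀ q ∈ m.primeFactors, IsKolyvaginPrime N₀ W K p q ∧ FrobEqFrobInfty W K (p ^ (2 * M₀ + k)) q) →
      conjAct W c _ (cl m) = (ε * (-1) ^ m.primeFactors.card) • cl m ∧
      (∀ v : HeightOneSpectrum (𝓞 K), (m : 𝓞 K) ∉ v.asIdeal →
        cl m ∈ selmerLocalKer (W.baseChange K) (v.adicCompletion K) ((p ^ M₀ * p ^ M₀ : ℕ) : ℤ)) ∧
      (∀ ℓ : ℕ, ℓ.Prime → ℓ ∣ m → ∀ v : HeightOneSpectrum (𝓞 K), (ℓ : 𝓞 K) ∈ v.asIdeal →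
        ∀ a : ℕ, (((p : ℤ) ^ a) • cl m ∈
            selmerLocalKer (W.baseChange K) (v.adicCompletion K) ((p ^ M₀ * p ^ M₀ : ℕ) : ℤ) ↔
          ((p : ℤ) ^ a) • cl (m / ℓ) ∈
            (W.baseChange K).torsionLocalKer (v.adicCompletion K) ((p ^ M₀ * p ^ M₀ : ℕ) : ℤ))))
    (e : geomTorsion (W.baseChange K) ((p ^ M₀ * p ^ M₀ : ℕ) : ℤ) →
      geomTorsion (W.baseChange K) ((p ^ M₀ * p ^ M₀ : ℕ) : ℤ) → AlgebraicClosure K)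
    (hμ : ∀ S T, e S T ^ (p ^ M₀ * p ^ M₀) = 1)
    (hadd₁ : ∀ S₁ S₂ T, e (S₁ + S₂) T = e S₁ T * e S₂ T)
    (hadd₂ : ∀ S T₁ T₂, e S (T₁ + T₂) = e S T₁ * e S T₂)
    (hgal : ∀ (σ : absoluteGaloisGroup K) (S T : geomTorsion (W.baseChange K) ((p ^ M₀ * p ^ M₀ : ℕ) : ℤ)),
      σ • e S T = e (σ • S) (σ • T))
    (halt : ∀ T, e T T = 1) (hnondeg : ∀ T, (∀ S, e S T = 1) → T = 0)
    (inv : LocalInvariants K (p ^ M₀ * p ^ M₀))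
    (hinv : ∀ v : HeightOneSpectrum (𝓞 K), Injective (inv (Sum.inr v))) :
    ∀ ℓ m : ℕ,
      (hℓ : IsKolyvaginPrime N₀ W K p ℓ ∧ FrobEqFrobInfty W K (p ^ (2 * M₀ + k)) ℓ) →
      KolSupp (fun q => IsKolyvaginPrime N₀ W K p q ∧ FrobEqFrobInfty W K (p ^ (2 * M₀ + k)) q) (ℓ * m) →
      ¬ ℓ ∣ m →
      ∀ (j N a b : ℕ) (t : galH1Torsion (W.baseChange K) ((p ^ M₀ * p ^ M₀ : ℕ) : ℤ)),
      t ∈ selmerGroup (W.baseChange K) ((p ^ M₀ * p ^ M₀ : ℕ) : ℤ) →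
      ((p : ℤ) ^ j) • cl (ℓ * m) ∈ selmerGroup (W.baseChange K) ((p ^ M₀ * p ^ M₀ : ℕ) : ℤ) →
      ((p : ℤ) ^ N) • t = 0 →
      conjAct W c ((p ^ M₀ * p ^ M₀ : ℕ) : ℤ) t = (ε * (-1) ^ (ℓ * m).primeFactors.card) • t →
      (∀ q ∈ m.primeFactors, ∀ v : HeightOneSpectrum (𝓞 K), (q : 𝓞 K) ∈ v.asIdeal →
        t ∈ (W.baseChange K).torsionLocalKer (v.adicCompletion K) ((p ^ M₀ * p ^ M₀ : ℕ) : ℤ)) →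
      M₀ ≤ j → N ≤ M₀ → N ≤ j → a + b + 1 = N →
      (¬ ∀ v : HeightOneSpectrum (𝓞 K), (ℓ : 𝓞 K) ∈ v.asIdeal →
        ((p : ℤ) ^ (a + (j - N))) • cl m ∈
          (W.baseChange K).torsionLocalKer (v.adicCompletion K) ((p ^ M₀ * p ^ M₀ : ℕ) : ℤ)) →
      (¬ ∀ v : HeightOneSpectrum (𝓞 K), (ℓ : 𝓞 K) ∈ v.asIdeal →
        ((p : ℤ) ^ b) • t ∈ (W.baseChange K).torsionLocalKer (v.adicCompletion K) ((p ^ M₀ * p ^ M₀ : ℕ) : ℤ)) →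
      ∀ D : FirstCaseData (W.baseChange K) (p ^ M₀), D.b₁ = ((p : ℤ) ^ (j - M₀)) • cl (ℓ * m) →
        galoisCohomology.map (inclKD (W.baseChange K) (p ^ M₀) (p ^ M₀)) 1 D.b' = t →
        D.localTerm e hμ hadd₁ hadd₂ hgal inv (Sum.inr hℓ.1.place) ≠ 0 := by
  intro ℓ m hℓ hsupp _hℓm j N a b t ht _hz hNt hτt _htq hMj hNM hNj hab hclm htb D hDb₁ hDb' hD0
  have hdk : p ^ M₀ * p ^ M₀ ∣ p ^ (2 * M₀ + k) := by
    rw [← pow_add, ← two_mul]; exact pow_dvd_pow p (Nat.le_add_right _ _)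
  haveI : Fact p.Prime := ⟨hp⟩
  have hn2 : p ^ M₀ * p ^ M₀ = p ^ (2 * M₀) := by rw [two_mul, pow_add]
  -- good reduction at `λ`, `m² ∉ λ`
  have hgood : (W.baseChange K).HasGoodReductionAt hℓ.1.place :=
    hasGoodReductionAt_place_of_isKolyvaginPrime_of_conductorNorm W hN hℓ.1
  have hpv : ((p : ℕ) : 𝓞 K) ∉ hℓ.1.place.asIdeal :=
    not_natCast_mem_of_prime_ne hℓ.1.prime hp hℓ.1.2.2.2.1 hℓ.1.place hℓ.1.mem_place
  have hqv : ((((p ^ M₀ * p ^ M₀ : ℕ) : ℤ)) : 𝓞 K) ∉ hℓ.1.place.asIdeal := by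
    rw [Int.cast_natCast, Nat.cast_mul, Nat.cast_pow]
    intro h
    rcases hℓ.1.place.isPrime.mem_or_mem h with h1 | h1 <;>
      exact hpv (hℓ.1.place.isPrime.mem_of_pow_mem _ h1)
  -- the sign `ν = ε (-1)^{ω(ℓm)}`
  have hν1 : ε * (-1) ^ (ℓ * m).primeFactors.card = 1 ∨ ε * (-1) ^ (ℓ * m).primeFactors.card = -1 := by
    rcases hε with rfl | rfl <;> rcases neg_one_pow_eq_or ℤ (ℓ * m).primeFactors.card with h | h <;>
      simp [h]
  -- the vacuous range: `p^{a + (j - N)} cl(m) = 0` when `a + (j - N) ≥ 2M₀`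
  by_cases hbig : 2 * M₀ ≤ a + (j - N)
  · refine hclm fun v _ => ?_
    have h0 : ((p : ℤ) ^ (a + (j - N))) • cl m = 0 := by
      obtain ⟨r, hr⟩ : ∃ r, a + (j - N) = 2 * M₀ + r := ⟨_, (Nat.add_sub_cancel' hbig).symm⟩
      have hs : (p : ℤ) ^ (a + (j - N)) = (p : ℤ) ^ r * ((p ^ M₀ * p ^ M₀ : ℕ) : ℤ) := by
        rw [hr]; push_cast; ring
      have ht0 : (((p ^ M₀ * p ^ M₀ : ℕ) : ℤ)) • cl m = 0 := by
        have h := zsmul_discreteH1_torsion ((p ^ M₀ * p ^ M₀ : ℕ) : ℤ) (cl m)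
        exact_mod_cast h
      rw [hs, mul_smul, ht0, zsmul_zero]
    rw [h0]
    exact zero_mem _
  push Not at hbig
  -- `p^{a + (j - N)} cl(ℓm)` is not Selmer at `λ` (McCallum Prop. 4.4, clause of `hcl`)
  have hdv : ((p : ℤ) ^ (a + (j - N))) • cl (ℓ * m) ∉
      selmerLocalKer (W.baseChange K) (hℓ.1.place.adicCompletion K) ((p ^ M₀ * p ^ M₀ : ℕ) : ℤ) := by
    intro hsel
    refine hclm fun v hv => ?_
    rw [hℓ.1.mem_iff.mp hv]
    have key := (hcl (ℓ * m) hsupp.1 hsupp.2).2.2 ℓ hℓ.1.prime (dvd_mul_right ℓ m) hℓ.1.place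
      hℓ.1.mem_place (a + (j - N))
    rw [Nat.mul_div_cancel_left m hℓ.1.prime.pos] at key
    exact key.mp hsel
  -- the twisted reciprocity value from the vanishing local term
  have hTw := exists_twisted_value_of_localTerm_eq_zero N₀ W K hp hM₀ rfl hℓ.1 hgood e hμ hadd₁ hadd₂
    hgal halt hnondeg inv (hinv _) D hDb' hD0
  -- the rescaled Selmer class `s' = p^{(j - 2M₀)⁺} t` and the twist `k = (2M₀ - j)⁺`
  set r := j - 2 * M₀ with hrdef
  set k := 2 * M₀ - j with hkdef
  set s' := ((p : ℤ) ^ r) • t with hs'def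
  have hs' : s' ∈ selmerGroup (W.baseChange K) ((p ^ M₀ * p ^ M₀ : ℕ) : ℤ) :=
    (selmerGroup (W.baseChange K) _).zsmul_mem ht _
  have hτs' : conjAct W c _ s' = (ε * (-1) ^ (ℓ * m).primeFactors.card) • s' := by
    rw [hs'def, map_zsmul, hτt, smul_smul, smul_smul, mul_comm ((p : ℤ) ^ r)]
  have hd : conjAct W c _ (cl (ℓ * m)) = (ε * (-1) ^ (ℓ * m).primeFactors.card) • cl (ℓ * m) :=
    (hcl (ℓ * m) hsupp.1 hsupp.2).1
  have hka : k + (a + (j - N)) + 1 ≤ 2 * M₀ := by omega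
  -- McCallum's Lemma 5.3, twisted
  have hmain := lemma_5_3_descent_of_reciprocity_twisted W hK hp hp2 hc hℓ.1 (M := 2 * M₀) (by omega)
    hn2 (frobEqFrobInfty_of_dvd W K hdk hℓ.2) hgood (weilPairingHom (W.baseChange K) (p ^ M₀ * p ^ M₀) e hμ hadd₁ hadd₂)
    (weilPairingHom_self (W.baseChange K) _ e hμ hadd₁ hadd₂ halt)
    (TameCup.weilPairingHom_left_nondeg (W.baseChange K) _ e hμ hadd₁ hadd₂ halt hnondeg)
    hν1 hd hka hdv hs' hτs' ?_
  · -- `p^b t = p^{2M₀ - 1 - (a + (j - N)) - k} s'` dies at `λ`: contradiction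
    refine htb fun v hv => ?_
    rw [hℓ.1.mem_iff.mp hv]
    have hexp : ((p : ℤ) ^ b) • t = ((p : ℤ) ^ (2 * M₀ - 1 - (a + (j - N)) - k)) • s' := by
      rw [hs'def, smul_smul, ← pow_add (p : ℤ), show 2 * M₀ - 1 - (a + (j - N)) - k + r = b by omega]
    rw [hexp]
    exact hmain
  -- the twisted reciprocity input
  intro 𝔔 h𝔔 F hF hFfix σ hσ
  obtain ⟨P', hP', heP'⟩ := hTw 𝔔 h𝔔 F hF hFfix σ hσ
  have hσfix : σ ∈ torsionFixing (W.baseChange K) ((p ^ M₀ * p ^ M₀ : ℕ) : ℤ) :=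
    (mem_torsionFixing_iff _ _).mpr fun Q =>
      (W.baseChange K).smul_geomTorsion_eq_of_mem_inertia hgood hqv h𝔔 hσ Q
  refine ⟨(p ^ (j - M₀)) • P', ?_, ?_⟩
  · rw [smul_smul, ← pow_add p k (j - M₀), show k + (j - M₀) = r + M₀ by omega, pow_add p r M₀,
      ← smul_smul, hP',
      hs'def, h1Eval_zsmul _ _ _ _ hFfix, ← Nat.cast_pow, natCast_zsmul]
  · rw [← natCast_zsmul, KolyvaginEigenPow.pairing_zsmul_left, ← map_zsmul, Nat.cast_pow,
      ← h1Eval_zsmul _ _ _ _ hσfix, ← hDb₁, TameCup.weilPairingHom_eq_zero_iff]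
    exact heP'


end Summit.BirchSwinnertonDyer.BirchSwinnertonDyer.Theorems.ShimuraKolyvaginOrder
end
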